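import Summits.RiemannHypothesis.RiemannHypothesis.Theorems.TwoPrimeFoldRigidity.Negative.TensorReduction

/-!
# Line `tensor_tower` for crux K1 = `TwoPrimeFoldRigidity` (NEGATIVE line: proves ¬K1) — cdisprove g0, 2026-08-28

HONEST LABEL: record-negative; 0 toward RH; nothing here bears on the truth of RH.

Skeleton of the line that CLOSED the crux negatively.  Two stubs, both now theorems of the tree:
* `stub_reduction` = `Negative/TensorReduction.twoPrimeFoldRigidity_false_of_towers` (p654599): towers for two steps ⇒ ¬K1;
* `stub_tower h`   = `Negative/MomentBlindTower` chain, `MBT.momentBlindTower_exists h` (MBTDefs p656656 + 6 parts):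
  one-lattice moment-blind towers exist for every step `h > 0`.
Composition = `Theorems/IntegerScrewTwoPrimeFoldRigidityRefutation.lean`.
Why it beats Lines/spill_budget and Lines/theta_uniform: the product configuration has NO cross-lattice spill, so no
coupled budget / Diophantine separation of `log 2, log 3` is needed; each lattice is handled by its own tower.
-/

set_option linter.dupNamespace false

namespace Summit.RiemannHypothesis.RiemannHypothesis.Cruxes.TwoPrimeFoldRigidity.Lines.TensorTower

open scoped ComplexConjugate

/-- stub T (tower existence for step `h`); PROVED in the tree chain as `MBT.momentBlindTower_exists` — the `sorry`
here only keeps this skeleton independent of the parts still landing. -/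
theorem stub_tower (h : ℝ) (hh : 0 < h) :
    ∃ (ι : Type) (μ : ι → ℝ) (κ : ι → ℂ), Nonempty ι ∧ (∀ i, 0 < μ i) ∧
      (∀ i, 0 < (κ i).re ∧ (κ i).re < 1 / 4) ∧ (∀ i, 1 < (κ i).im) ∧
      (∀ T : ℝ, {i | (κ i).im ≤ T}.Finite) ∧ Summable (fun i ↦ μ i * ‖κ i‖ ^ 2) ∧
      ∀ k : ℕ, 1 ≤ k → ∀ r : ℕ, r ≤ 2 →
        HasSum (fun i ↦ (μ i : ℂ) * conj (κ i) ^ r * Complex.exp (κ i * (((k : ℝ) * h : ℝ) : ℂ))) 0 := by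
  sorry

/-- the line closes the crux NEGATIVELY: `¬ K1` from the two stubs (kernel composition; the reduction stub is the
accepted theorem). -/
theorem TwoPrimeFoldRigidity_false :
    ¬ Summit.RiemannHypothesis.RiemannHypothesis.Theses.IntegerScrew.TwoPrimeFoldRigidity := by
  obtain ⟨P, μ, κ, hne, hμ, hre, him, hfin, hsum, hbl⟩ := stub_tower (Real.log 2) (Real.log_pos one_lt_two)
  obtain ⟨Q, ν, κ', hne', hν, hre', him', hfin', hsum', hbl'⟩ :=
    stub_tower (Real.log 3) (Real.log_pos (by norm_num))
  exact Theorems.TwoPrimeFoldRigidity.Negative.twoPrimeFoldRigidity_false_of_towers hne hne' μ κ ν κ' hμ hre him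
    hfin hsum hbl hν hre' him' hfin' hsum' hbl'

end Summit.RiemannHypothesis.RiemannHypothesis.Cruxes.TwoPrimeFoldRigidity.Lines.TensorTower
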